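import Summits.AtomisticToContinuum.Crystallization.Theorems.ChargedEnergyGap.Negative.PeriodicFormConverse
import Literature.MathematicalPhysics.StatisticalMechanics.BarlowRings

/-!
# `ChargedEnergyGap` (stmt-AtomisticToContinuum-14231), negative side IX: the periodic pricing is blind to the whole ideal Barlow family

The link charge never sees stacking or density.  For EVERY Hägg sequence `s` (any stacking
word), every scale `a > 0` with the ideal spacing `h² = ⅔a²`, and EVERY tolerance
`0 ≤ η < √2 − 1`, every point of the close-packed stacking `barlowStacking a h s` is charge-free
in the scale-free bond graph (`isChargeFree_barlowStacking`: nearest-neighbour distance `a`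
everywhere, bonds = touching pairs by the distance gap `(a, √2·a)` of `BarlowRings`, twelve of
them by `ncard_touching_eq_twelve`, ring number four across each by
`ncard_commonTouching_eq_four`).  Consequently, for every periodic Hägg sequence the periodic
configuration `barlowPeriodicConfiguration` has NO charged motif site
(`motifCharged_idealBarlowQ_eq_zero`), and the periodic form of the crux
(`PeriodicPricing η κ`, part V; `ChargedEnergyGap ↔ ∃ κ > 0, PeriodicPricing (1/100) κ`, part VII)
holds AT every such configuration for every price `κ`, with slack exactly its excess energy
(`periodicPricing_at_idealBarlowQ`): the priced gap constrains neither the stacking word nor the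
density of a close-packed candidate, and a proof of the crux can extract from it nothing about
hcp-versus-fcc or about the lattice constant — the charge form of the catalogued barrier
`Literature.Barriers.AtomisticToContinuum.ShortRangeStackingBlindness`.  In particular the three
kill criteria of part VIII can only fire through NON-close-packed periodic configurations (or
close-packed ones distorted by more than the tolerance).  On the way: the first Lean-certified
inhabitants of `IsChargeFree η` in `ℝ³` (`0 ≤ η < √2 − 1`), i.e. the target `ZeroChargeBulk` and
the crux are not false for want of charge-free sites.  All `[folklore]`.
-/

noncomputable section

namespace Summit.AtomisticToContinuum.Crystallization.Theorems.ChargedEnergyGapNegative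

open Literature.MathematicalPhysics.StatisticalMechanics
open Literature.Geometry.DiscreteGeometry
open Summit.AtomisticToContinuum.Crystallization.Theses.PricedLinkCensus
open scoped BigOperators

namespace Barlow

variable {a h : ℝ} {s : ℤ → ℤ}

/-- The ideal stacking as a configuration indexed by its own points. [folklore] -/
abbrev cfg (a h : ℝ) (s : ℤ → ℤ) : barlowStacking a h s → E3 := Subtype.val

/-- Some point of the stacking touches `p` (there are twelve). [folklore] -/
theorem exists_touching (hs : IsHaggSeq s) (ha : 0 < a) (hh : h ^ 2 = 2 / 3 * a ^ 2)
    (p : barlowStacking a h s) : ∃ q : barlowStacking a h s, dist p.1 q.1 = a := by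
  have h12 := ncard_touching_eq_twelve hs ha hh p.2
  have hne : {w | w ∈ barlowStacking a h s ∧ dist p.1 w = a}.Nonempty := by
    by_contra h0
    rw [Set.not_nonempty_iff_eq_empty] at h0
    rw [h0, Set.ncard_empty] at h12
    exact absurd h12 (by norm_num)
  obtain ⟨w, hw, hd⟩ := hne
  exact ⟨⟨w, hw⟩, hd⟩

/-- A touching point is a different point (`a > 0`). [folklore] -/
theorem ne_of_dist_eq (ha : 0 < a) {p q : barlowStacking a h s} (hd : dist p.1 q.1 = a) : q ≠ p := by
  rintro rfl
  rw [dist_self] at hd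
  exact ha.ne hd

/-- **Every nearest-neighbour distance of the ideal stacking is `a`.** [folklore] -/
theorem nearestDist_eq (hs : IsHaggSeq s) (ha : 0 < a) (hh : h ^ 2 = 2 / 3 * a ^ 2)
    (p : barlowStacking a h s) : nearestDist (cfg a h s) p = a := by
  obtain ⟨q, hq⟩ := exists_touching hs ha hh p
  have hne := ne_of_dist_eq ha hq
  refine le_antisymm ((nearestDist_le_dist (cfg a h s) hne).trans_eq hq) ?_
  refine le_nearestDist ⟨q, hne⟩ fun k hk => ?_
  exact le_dist_of_mem_barlowStacking_ideal hs ha hh p.2 k.2 fun h' => hk (Subtype.ext h').symm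

/-- **Bonds of the ideal stacking are exactly the touching pairs**, at every tolerance
`0 ≤ η` with `1 + η < √2`. [folklore] -/
theorem adj_iff (hs : IsHaggSeq s) (ha : 0 < a) (hh : h ^ 2 = 2 / 3 * a ^ 2) {η : ℝ}
    (hη0 : 0 ≤ η) (hη : 1 + η < Real.sqrt 2) (p q : barlowStacking a h s) :
    (bondGraph η (cfg a h s)).Adj p q ↔ dist p.1 q.1 = a := by
  rw [bondGraph_adj, nearestDist_eq hs ha hh, nearestDist_eq hs ha hh, min_self]
  constructor
  · rintro ⟨hne, hle⟩
    have ht : (1 + η) * a < Real.sqrt 2 * a := mul_lt_mul_of_pos_right hη ha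
    exact dist_eq_of_dist_le_of_lt hs ha hh p.2 q.2 (fun h' => hne (Subtype.ext h')) ht hle
  · intro hd
    refine ⟨fun h' => (ne_of_dist_eq ha hd) h'.symm, ?_⟩
    rw [hd]
    nlinarith

/-- The neighbour set of a point: the touching points. [folklore] -/
theorem neighborSet_eq (hs : IsHaggSeq s) (ha : 0 < a) (hh : h ^ 2 = 2 / 3 * a ^ 2) {η : ℝ}
    (hη0 : 0 ≤ η) (hη : 1 + η < Real.sqrt 2) (p : barlowStacking a h s) :
    (bondGraph η (cfg a h s)).neighborSet p =
      Subtype.val ⁻¹' {w | w ∈ barlowStacking a h s ∧ dist p.1 w = a} := by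
  ext q
  rw [SimpleGraph.mem_neighborSet, adj_iff hs ha hh hη0 hη]
  simp only [Set.mem_preimage, Set.mem_setOf_eq]
  exact ⟨fun hd => ⟨q.2, hd⟩, fun h => h.2⟩

/-- **Twelve bonds at every point.** [folklore] -/
theorem ncard_neighborSet (hs : IsHaggSeq s) (ha : 0 < a) (hh : h ^ 2 = 2 / 3 * a ^ 2) {η : ℝ}
    (hη0 : 0 ≤ η) (hη : 1 + η < Real.sqrt 2) (p : barlowStacking a h s) :
    ((bondGraph η (cfg a h s)).neighborSet p).ncard = 12 := by
  rw [neighborSet_eq hs ha hh hη0 hη,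
    Set.ncard_preimage_of_injective_subset_range Subtype.val_injective
      (by rintro w ⟨hw, -⟩; exact ⟨⟨w, hw⟩, rfl⟩)]
  exact ncard_touching_eq_twelve hs ha hh p.2

/-- **Ring number four across every bond.** [folklore] -/
theorem ringNumber_eq (hs : IsHaggSeq s) (ha : 0 < a) (hh : h ^ 2 = 2 / 3 * a ^ 2) {η : ℝ}
    (hη0 : 0 ≤ η) (hη : 1 + η < Real.sqrt 2) {p q : barlowStacking a h s}
    (hd : dist p.1 q.1 = a) : ringNumber η (cfg a h s) p q = 4 := by
  rw [ringNumber_def, neighborSet_eq hs ha hh hη0 hη, neighborSet_eq hs ha hh hη0 hη,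
    ← Set.preimage_inter]
  have hset : {w | w ∈ barlowStacking a h s ∧ dist p.1 w = a} ∩
      {w | w ∈ barlowStacking a h s ∧ dist q.1 w = a} =
        {w | w ∈ barlowStacking a h s ∧ dist p.1 w = a ∧ dist q.1 w = a} := by
    ext w
    simp only [Set.mem_inter_iff, Set.mem_setOf_eq]
    tauto
  rw [hset, Set.ncard_preimage_of_injective_subset_range Subtype.val_injective
      (by rintro w ⟨hw, -⟩; exact ⟨⟨w, hw⟩, rfl⟩)]
  exact ncard_commonTouching_eq_four hs ha hh p.2 q.2 hd

/-- **Every point of an ideal close-packed Barlow stacking is charge-free**, at every tolerance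
`0 ≤ η` with `1 + η < √2` (any Hägg sequence, any scale). [folklore] -/
theorem isChargeFree_barlowStacking (hs : IsHaggSeq s) (ha : 0 < a) (hh : h ^ 2 = 2 / 3 * a ^ 2)
    {η : ℝ} (hη0 : 0 ≤ η) (hη : 1 + η < Real.sqrt 2) (p : barlowStacking a h s) :
    IsChargeFree η (cfg a h s) p := by
  refine ⟨ncard_neighborSet hs ha hh hη0 hη p, fun q hq => ?_⟩
  rw [SimpleGraph.mem_neighborSet, adj_iff hs ha hh hη0 hη] at hq
  exact ringNumber_eq hs ha hh hη0 hη hq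

/-- The tolerance `1/100` of the crux is in the window: `1 + 1/100 < √2`. [folklore] -/
theorem one_add_lt_sqrt_two : (1 : ℝ) + 1 / 100 < Real.sqrt 2 := by
  rw [show (1 : ℝ) + 1 / 100 = 101 / 100 by norm_num, Real.lt_sqrt (by norm_num)]
  norm_num

/-- **`IsChargeFree (1/100)` is inhabited in `ℝ³`** (by every point of every ideal close-packed
stacking; here: fcc at scale `1`). [folklore] -/
theorem exists_isChargeFree :
    ∃ (S : Set E3) (p : S), S.Infinite ∧ IsChargeFree (1 / 100) (Subtype.val : S → E3) p := by
  have hh : (Real.sqrt (2 / 3)) ^ 2 = 2 / 3 * (1 : ℝ) ^ 2 := by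
    rw [Real.sq_sqrt (by norm_num)]; norm_num
  refine ⟨barlowStacking 1 (Real.sqrt (2 / 3)) constHagg,
    ⟨_, barlowPos_mem (a := 1) (h := Real.sqrt (2 / 3)) (s := constHagg) 0 0 0⟩,
    ?_, isChargeFree_barlowStacking isHaggSeq_const one_pos hh (by norm_num) one_add_lt_sqrt_two _⟩
  -- the layer-`k` points `barlowPos 1 h const k 0 0`, `k : ℤ`, are pairwise distinct
  have hinj : Function.Injective fun k : ℤ => barlowPos 1 (Real.sqrt (2 / 3)) constHagg k 0 0 := by
    intro k k' hkk
    have := congrArg (fun v : E3 => v 2) hkk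
    simp only [barlowPos_apply_two] at this
    have hs0 : (0 : ℝ) < Real.sqrt (2 / 3) := Real.sqrt_pos.2 (by norm_num)
    exact_mod_cast mul_right_cancel₀ hs0.ne' this
  exact Set.infinite_of_injective_forall_mem hinj fun k =>
    barlowPos_mem (a := 1) (h := Real.sqrt (2 / 3)) (s := constHagg) k 0 0

end Barlow

/-! ## The periodic configurations of periodic Hägg sequences carry no charge -/

section Periodic

open Blocks Barlow

variable {a h : ℝ} {s : ℤ → ℤ} {p : ℕ}

/-- `h ≠ 0` at the ideal spacing. [folklore] -/
theorem h_ne_zero (ha : 0 < a) (hh : h ^ 2 = 2 / 3 * a ^ 2) : h ≠ 0 := by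
  rintro rfl
  nlinarith

/-- The periodic configuration of a `p`-periodic Hägg sequence `s` at scale `a > 0` and ideal
spacing `h² = ⅔a²` (`BarlowStacking.barlowPeriodicConfiguration`). [folklore] -/
def idealBarlowQ (ha : 0 < a) (hh : h ^ 2 = 2 / 3 * a ^ 2) (hp : p ≠ 0)
    (hper : ∀ i, s (i + p) = s i) : PeriodicConfiguration 3 :=
  barlowPeriodicConfiguration (a := a) (h := h) s ha.ne' (h_ne_zero ha hh) hp hper

/-- Its point set is the stacking. [folklore] -/
theorem idealBarlowQ_points (ha : 0 < a) (hh : h ^ 2 = 2 / 3 * a ^ 2) (hp : p ≠ 0)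
    (hper : ∀ i, s (i + p) = s i) : (idealBarlowQ ha hh hp hper).points = barlowStacking a h s :=
  barlowPeriodicConfiguration_points s _ _ hp hper

/-- **Every point of the periodic configuration of a periodic Hägg sequence is charge-free**
(`0 ≤ η`, `1 + η < √2`). [folklore] -/
theorem isChargeFree_idealBarlowQ (hs : IsHaggSeq s) (ha : 0 < a) (hh : h ^ 2 = 2 / 3 * a ^ 2)
    (hp : p ≠ 0) (hper : ∀ i, s (i + p) = s i) {η : ℝ} (hη0 : 0 ≤ η) (hη : 1 + η < Real.sqrt 2)
    (q : (idealBarlowQ ha hh hp hper).points) :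
    IsChargeFree η (ptConfig (idealBarlowQ ha hh hp hper)) q := by
  have hpts := idealBarlowQ_points ha hh hp hper
  let e : barlowStacking a h s ≃ (idealBarlowQ ha hh hp hper).points := Equiv.setCongr hpts.symm
  have hcomp : ptConfig (idealBarlowQ ha hh hp hper) ∘ e = cfg a h s := by
    funext x; rfl
  have := (isChargeFree_comp_equiv_iff η (ptConfig (idealBarlowQ ha hh hp hper)) e (e.symm q)).1
    (by rw [hcomp]; exact isChargeFree_barlowStacking hs ha hh hη0 hη _)
  simpa using this

/-- **No charged motif site**: `motifCharged η Q = 0` for the periodic configuration of every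
periodic Hägg sequence at the ideal spacing, every scale, every `0 ≤ η < √2 − 1`. [folklore] -/
theorem motifCharged_idealBarlowQ_eq_zero (hs : IsHaggSeq s) (ha : 0 < a)
    (hh : h ^ 2 = 2 / 3 * a ^ 2) (hp : p ≠ 0) (hper : ∀ i, s (i + p) = s i) {η : ℝ} (hη0 : 0 ≤ η)
    (hη : 1 + η < Real.sqrt 2) : motifCharged η (idealBarlowQ ha hh hp hper) = 0 := by
  unfold motifCharged
  haveI : IsEmpty {x : (idealBarlowQ ha hh hp hper).motif //
      ¬ IsChargeFree η (Subtype.val : (idealBarlowQ ha hh hp hper).points → E3)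
        ⟨x.1, (idealBarlowQ ha hh hp hper).mem_points_of_mem_motif x.2⟩} :=
    ⟨fun x => x.2 (isChargeFree_idealBarlowQ hs ha hh hp hper hη0 hη _)⟩
  exact Nat.card_of_isEmpty

/-- **The periodic pricing is vacuous on the ideal Barlow family**: at every such configuration
the inequality `κ·motifCharged ≤ #motif·(e(Q) − e*)` reads `0 ≤ #motif·(e(Q) − e*)`, true for
every `κ` (`e* ≤ e(Q)`, part BlocksBound) — whatever the stacking word and the density.
[folklore] -/
theorem periodicPricing_at_idealBarlowQ (hs : IsHaggSeq s) (ha : 0 < a)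
    (hh : h ^ 2 = 2 / 3 * a ^ 2) (hp : p ≠ 0) (hper : ∀ i, s (i + p) = s i) {η : ℝ} (hη0 : 0 ≤ η)
    (hη : 1 + η < Real.sqrt 2) (κ : ℝ) :
    κ * (motifCharged η (idealBarlowQ ha hh hp hper) : ℝ) ≤
      ((idealBarlowQ ha hh hp hper).motif.card : ℝ) *
        ((idealBarlowQ ha hh hp hper).energyPerParticle lennardJones - eStar) := by
  rw [motifCharged_idealBarlowQ_eq_zero hs ha hh hp hper hη0 hη, Nat.cast_zero, mul_zero]
  exact mul_nonneg (Nat.cast_nonneg _) (sub_nonneg.2 (eStar_le _))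

/-- The crux's tolerance: the hcp and fcc periodic configurations of the tree
(`hcpPeriodicConfiguration`, `fccPeriodicConfiguration`) at the ideal spacing, any scale
`a > 0`, have no charged motif site at `η = 1/100`. [folklore] -/
theorem motifCharged_hcp_fcc_eq_zero (ha : 0 < a) (hh : h ^ 2 = 2 / 3 * a ^ 2) (hh0 : h ≠ 0) :
    motifCharged (1 / 100) (hcpPeriodicConfiguration (a := a) (h := h) ha.ne' hh0) = 0 ∧
      motifCharged (1 / 100) (fccPeriodicConfiguration (a := a) (h := h) ha.ne' hh0) = 0 :=
  ⟨motifCharged_idealBarlowQ_eq_zero isHaggSeq_alternating ha hh two_ne_zero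
      alternatingHagg_periodic (by norm_num) one_add_lt_sqrt_two,
    motifCharged_idealBarlowQ_eq_zero isHaggSeq_const ha hh one_ne_zero (fun _ => rfl)
      (by norm_num) one_add_lt_sqrt_two⟩

end Periodic

end Summit.AtomisticToContinuum.Crystallization.Theorems.ChargedEnergyGapNegative

end
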